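import Summits.QuantumFields.YangMills.Theorems.VirialFluxGapFixOrbitTube
import Summits.QuantumFields.YangMills.Theorems.VirialFluxGapFixDimCount
import Summits.QuantumFields.YangMills.Theorems.VirialFluxGapSharpTwistedLaplaceDetBounds
import HarnessLib

/-!
# ★★★ The per-tube estimate on `X_fix` in the LITERAL format of hypothesis `htube` of ✓`sharpTwistedLaplace_of_fixTubes`
# (layers (B2)+(B3) of the DIRECT Laplace road to ⟨stmt-QuantumFields-24204⟩ `VirialFluxGap.SharpTwistedLaplace`)

Helper module (free-hands work of width seat ym-line-sfw-p2-w3 g57, cell ym-idea-1; `--supports 24204`).  ✓`fix_htube_of_sliceData` (…FixOrbitTube)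
combined with ✓`finrank_fixModel` (`dim V = 18L⁴`, …FixDimCount), the CRITICAL VALUE `F_fix(σ 0) = 0` (hypothesis `hF0`) and the positivity of
`det A` for a coercive symmetric `A` (✓`QuantitativeLaplace.pow_le_det_of_coercive`):
* ★★★ `fix_htube_final` — with anchor-only constants `r₀ D G A₀ c_ν`, for every slice datum and window `R`:
  `0 < c`, integrability, and `|∫_T e^{−βF_fix} dμ_fix − c·(2π/β)^{9L⁴}| ≤ (K/β)·c·(2π/β)^{9L⁴}` with `c = A₀(2π²)^{−N}/(c_ν √det A)` and
  `K = K(18L⁴, λ, A₃, A₄, D, G, R)` explicit (polynomial in `L` by ✓`orbitConst_le_poly` once `1/λ, A₃, A₄, 1/R ≤ poly(L)`).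
This is hypothesis `htube` of ✓`sharpTwistedLaplace_of_fixTubes` for the tube `T = SU(2)·σ(B̄_R)` of ONE sign class.  What the final assembly still
needs: the slice datum per class (w2 g50: ✓`exists_phase_package_fixCoord`), `F_fix(σ_s 0) = 0`, the off-tube floor, pairwise disjointness of the
finitely many tubes, and the log-bookkeeping `|log Σ_s c_s| ≤ poly(L)` (✓`abs_log_det_le`).
Everything here is PROVED; no definitions, no named facts.  HONEST FRAMING: CONDITIONAL assembly step; ⟨24204⟩, ⟨24319⟩ and every rung stay OPEN;
the Yang–Mills mass gap (Clay) is NOT touched; no summit is proved by a line.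

## References
* K. W. Breitung, *Asymptotic Approximations for Probability Integrals*, LNM 1592 (1994), Thm 41 p. 56; §2.3. [Breitung1994]
* G. E. Bredon, *Introduction to Compact Transformation Groups* (1972), Ch. II §§4–5. [Bredon1972]
* M. Lüscher, *Nucl. Phys. B* 219 (1983) 233–261, §2. [Luscher1983]
-/

set_option autoImplicit false

noncomputable section

open MeasureTheory Set Filter Metric WithLp Module
open scoped ENNReal RealInnerProductSpace Pointwise
open Literature.MathematicalPhysics.QuantumLattice
open Literature.MathematicalPhysics.QuantumFieldTheory hiding SU2
open Literature.MathematicalPhysics.QuantumFieldTheory.Balaban1983to89.T4HaarSU2ExpChart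
open Literature.MathematicalPhysics.QuantumFieldTheory.Balaban1983to89.T4ExpWindowSmallField
open Summit.QuantumFields.YangMills.Theorems.FemtoTransferGap
open Summit.QuantumFields.YangMills.Theorems.FemtoTransferGap.TT
open Summit.QuantumFields.YangMills.Theorems.VirialFluxGap.AnchorSlice
open Summit.QuantumFields.YangMills.Theorems.VirialFluxGap.RingDeficit
open Summit.QuantumFields.YangMills.Theorems.QuantitativeLaplace

namespace Summit.QuantumFields.YangMills.Theorems.VirialFluxGap.FixSplit

/-- ★★★ **THE PER-TUBE ESTIMATE IN `htube` FORMAT** (see the module docstring).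
[cite: Breitung1994, Thm 41 p. 56; §2.3 Definitions 4–5] [cite: Bredon1972, Ch. II §§4–5] [cite: Luscher1983, §2] -/
theorem fix_htube_final {ωC ωN ωX : EuclideanSpace ℝ (Fin 3)} {C₀ N₀ : SU2} (hC : ‖ωC‖ = 1) (hN : ‖ωN‖ = 1)
    (hCN : ⟪ωC, ωN⟫ = 0) (hX : imQuat ωX = imQuat ωC * imQuat ωN) (hC₀ : su2Quat C₀ = imQuat ωC)
    (hN₀ : su2Quat N₀ = imQuat ωN ∨ su2Quat N₀ = -imQuat ωN) :
    ∃ r₀ D G A₀ cν : ℝ, 0 < r₀ ∧ r₀ < 1 ∧ 0 ≤ D ∧ 0 ≤ G ∧ 0 < A₀ ∧ 0 < cν ∧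
      ∀ (L : ℕ) [NeZero L] (e₀ : OffIdx L) (y₀ : Site 3 L) (Rb : FixRest L e₀ y₀) (zc : Fin 3 → Bool)
        (A : EuclideanSpace ℝ (Fin (fixDim L e₀ y₀)) →ₗ[ℝ] EuclideanSpace ℝ (Fin (fixDim L e₀ y₀))) (lam : ℝ)
        (hAs : A.IsSymmetric) (hlam : 0 < lam) (hcoer : ∀ y, lam * ‖y‖ ^ 2 ≤ ⟪A y, y⟫)
        (A₃ A₄ β R : ℝ) (hA₃ : 0 ≤ A₃) (hA₄ : 0 ≤ A₄) (hβ : 0 < β) (hR : 0 < R) (hRr : R ≤ r₀)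
        (hsmall : A₃ * R + A₄ * R ^ 2 ≤ lam / (8 * (18 * (L : ℝ) ^ 4 + 8)))
        (hDR : D * R ≤ 1) (hGR : G * R ^ 2 ≤ 1)
        (cc rr : EuclideanSpace ℝ (Fin (fixDim L e₀ y₀)) → ℝ) (hc_meas : Measurable cc) (hr_meas : Measurable rr)
        (hc_odd : ∀ y, cc (-y) = -cc y)
        (hc : ∀ y, ‖y‖ ≤ R → |cc y| ≤ A₃ * ‖y‖ ^ 3) (hr : ∀ y, ‖y‖ ≤ R → |rr y| ≤ A₄ * ‖y‖ ^ 4)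
        (hf : ∀ y : EuclideanSpace ℝ (Fin (fixDim L e₀ y₀)), ‖y‖ ≤ R →
          ringDeficit L zc ((Fin.cons (glue (fixSlice ωC ωN ωX C₀ N₀ Rb (fixCoord y)).1) (fixSlice ωC ωN ωX C₀ N₀ Rb (fixCoord y)).2.1 :
              Fin (2 * L - 1 + 1) → GaugeConfig 3 L SU2), (fixSlice ωC ωN ωX C₀ N₀ Rb (fixCoord y)).2.2) -
            ringDeficit L zc ((Fin.cons (glue (fixSlice ωC ωN ωX C₀ N₀ Rb (fixCoord 0)).1) (fixSlice ωC ωN ωX C₀ N₀ Rb (fixCoord 0)).2.1 :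
              Fin (2 * L - 1 + 1) → GaugeConfig 3 L SU2), (fixSlice ωC ωN ωX C₀ N₀ Rb (fixCoord 0)).2.2) =
            (1 / 2) * ⟪A y, y⟫ + cc y + rr y)
        (hF0 : ringDeficit L zc ((Fin.cons (glue (fixSlice ωC ωN ωX C₀ N₀ Rb (fixCoord 0)).1) (fixSlice ωC ωN ωX C₀ N₀ Rb (fixCoord 0)).2.1 :
              Fin (2 * L - 1 + 1) → GaugeConfig 3 L SU2), (fixSlice ωC ωN ωX C₀ N₀ Rb (fixCoord 0)).2.2) = 0),
        0 < A₀ * (2 * Real.pi ^ 2)⁻¹ ^ Fintype.card ({i : OffIdx L // ¬ i = e₀} ⊕ ((Fin (2 * L - 1) × Edge 3 L) ⊕ {y : Site 3 L // ¬ y = y₀})) / cν /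
            Real.sqrt (LinearMap.det A) ∧
        IntegrableOn (fun x : (OffIdx L → SU2) × ((Fin (2 * L - 1) → GaugeConfig 3 L SU2) × (Site 3 L → SU2)) =>
            Real.exp (-(β * ringDeficit L zc ((Fin.cons (glue x.1) x.2.1 : Fin (2 * L - 1 + 1) → GaugeConfig 3 L SU2), x.2.2))))
          ((fun q : SU2 × EuclideanSpace ℝ (Fin (fixDim L e₀ y₀)) =>
            (((fun i => q.1 * (fixSlice ωC ωN ωX C₀ N₀ Rb (fixCoord q.2)).1 i * q.1⁻¹),
              ((fun j => gaugeTransform (fun _ : Site 3 L => q.1) ((fixSlice ωC ωN ωX C₀ N₀ Rb (fixCoord q.2)).2.1 j)),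
                (fun s => q.1 * (fixSlice ωC ωN ωX C₀ N₀ Rb (fixCoord q.2)).2.2 s * q.1⁻¹))) :
              (OffIdx L → SU2) × ((Fin (2 * L - 1) → GaugeConfig 3 L SU2) × (Site 3 L → SU2)))) ''
            ((univ : Set SU2) ×ˢ closedBall (0 : EuclideanSpace ℝ (Fin (fixDim L e₀ y₀))) R))
          ((Measure.pi fun _ : OffIdx L => haarProbability SU2).prod
            ((Measure.pi fun _ : Fin (2 * L - 1) => configMeasure SU2 L).prod (gaugeMeasure L))) ∧
        |(∫ x, Real.exp (-(β * ringDeficit L zc ((Fin.cons (glue x.1) x.2.1 : Fin (2 * L - 1 + 1) → GaugeConfig 3 L SU2), x.2.2)))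
            ∂(((Measure.pi fun _ : OffIdx L => haarProbability SU2).prod
              ((Measure.pi fun _ : Fin (2 * L - 1) => configMeasure SU2 L).prod (gaugeMeasure L))).restrict
              ((fun q : SU2 × EuclideanSpace ℝ (Fin (fixDim L e₀ y₀)) =>
                (((fun i => q.1 * (fixSlice ωC ωN ωX C₀ N₀ Rb (fixCoord q.2)).1 i * q.1⁻¹),
                  ((fun j => gaugeTransform (fun _ : Site 3 L => q.1) ((fixSlice ωC ωN ωX C₀ N₀ Rb (fixCoord q.2)).2.1 j)),
                    (fun s => q.1 * (fixSlice ωC ωN ωX C₀ N₀ Rb (fixCoord q.2)).2.2 s * q.1⁻¹))) :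
                  (OffIdx L → SU2) × ((Fin (2 * L - 1) → GaugeConfig 3 L SU2) × (Site 3 L → SU2)))) ''
                ((univ : Set SU2) ×ˢ closedBall (0 : EuclideanSpace ℝ (Fin (fixDim L e₀ y₀))) R)))) -
          ((A₀ * (2 * Real.pi ^ 2)⁻¹ ^ Fintype.card ({i : OffIdx L // ¬ i = e₀} ⊕ ((Fin (2 * L - 1) × Edge 3 L) ⊕ {y : Site 3 L // ¬ y = y₀})) / cν /
            Real.sqrt (LinearMap.det A)) * (2 * Real.pi / β) ^ ((9 : ℝ) * (L : ℝ) ^ 4))| ≤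
          (16 * (18 * (L : ℝ) ^ 4 + 8) / (lam * R ^ 2) +
              16 * G * (18 * (L : ℝ) ^ 4 + 8) / lam +
            256 * (A₄ + (A₃ + A₄ * R) * (D + G * R)) * (18 * (L : ℝ) ^ 4 + 8) ^ 2 / lam ^ 2 +
            18432 * (A₃ + A₄ * R) ^ 2 * (18 * (L : ℝ) ^ 4 + 8) ^ 3 / lam ^ 3) / β *
          ((A₀ * (2 * Real.pi ^ 2)⁻¹ ^ Fintype.card ({i : OffIdx L // ¬ i = e₀} ⊕ ((Fin (2 * L - 1) × Edge 3 L) ⊕ {y : Site 3 L // ¬ y = y₀})) / cν /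
            Real.sqrt (LinearMap.det A)) * (2 * Real.pi / β) ^ ((9 : ℝ) * (L : ℝ) ^ 4)) := by
  obtain ⟨r₀, D, G, A₀, cν, hr₀, hr₀1, hD, hG, hA₀, hcν, hmain⟩ := fix_htube_of_sliceData hC hN hCN hX hC₀ hN₀
  refine ⟨r₀, D, G, A₀, cν, hr₀, hr₀1, hD, hG, hA₀, hcν, ?_⟩
  intro L _ e₀ y₀ Rb zc A lam hAs hlam hcoer A₃ A₄ β R hA₃ hA₄ hβ hR hRr hsmall hDR hGR cc rr hc_meas hr_meas hc_odd hc hr hf hF0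
  have hn : ((finrank ℝ (EuclideanSpace ℝ (Fin (fixDim L e₀ y₀))) : ℝ) + 8) = 18 * (L : ℝ) ^ 4 + 8 := by
    rw [finrank_fixModel]; push_cast; ring
  have hsmall' : A₃ * R + A₄ * R ^ 2 ≤ lam / (8 * ((finrank ℝ (EuclideanSpace ℝ (Fin (fixDim L e₀ y₀))) : ℝ) + 8)) := by
    rw [hn]; exact hsmall
  obtain ⟨hint, hest⟩ := hmain L e₀ y₀ Rb zc A lam hAs hlam hcoer A₃ A₄ β R hA₃ hA₄ hβ hR hRr hsmall' hDR hGR cc rr hc_meas hr_meas hc_odd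
    hc hr hf
  have hdet : 0 < LinearMap.det A :=
    lt_of_lt_of_le (pow_pos hlam _) (QuantitativeLaplace.pow_le_det_of_coercive hAs hlam.le hcoer)
  have hexp : ((finrank ℝ (EuclideanSpace ℝ (Fin (fixDim L e₀ y₀))) : ℝ) / 2) = (9 : ℝ) * (L : ℝ) ^ 4 := finrank_fixModel_div_two e₀ y₀
  have e : A₀ * (2 * Real.pi ^ 2)⁻¹ ^ Fintype.card ({i : OffIdx L // ¬ i = e₀} ⊕ ((Fin (2 * L - 1) × Edge 3 L) ⊕ {y : Site 3 L // ¬ y = y₀})) / cν *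
      ((2 * Real.pi / β) ^ (((finrank ℝ (EuclideanSpace ℝ (Fin (fixDim L e₀ y₀))) : ℝ) / 2)) / Real.sqrt (LinearMap.det A)) =
      (A₀ * (2 * Real.pi ^ 2)⁻¹ ^ Fintype.card ({i : OffIdx L // ¬ i = e₀} ⊕ ((Fin (2 * L - 1) × Edge 3 L) ⊕ {y : Site 3 L // ¬ y = y₀})) / cν /
        Real.sqrt (LinearMap.det A)) * (2 * Real.pi / β) ^ ((9 : ℝ) * (L : ℝ) ^ 4) := by
    rw [hexp]; ring
  simp only [hF0, sub_zero] at hint hest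
  rw [e, hn] at hest
  refine ⟨?_, hint, hest⟩
  have hc0 : 0 < (2 * Real.pi ^ 2)⁻¹ := by positivity
  positivity

end Summit.QuantumFields.YangMills.Theorems.VirialFluxGap.FixSplit

end
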